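import Literature.Geometry.Lorentzian.IsometryProofs
import HarnessLib

/-!
# Transporting a smooth field of bilinear forms along a smooth map; fields on the model space

Topic `Literature/Geometry/Manifold` (namespace `Literature.Geometry.Manifold`). Plumbing for
layer L1-(i) of the proof programme of `Literature.Geometry.Riemannian.BaerHankePscGluing`
(extension of the metric of a compact piece `M ⊂ P` with boundary to an open neighbourhood in
the boundaryless glued manifold `P`; Lee 2018, Example 6.44: "embed `M` in its double, extend
the metric smoothly"): a symmetric field of bilinear forms is produced LOCALLY, in a chart `K`
of `P`, as a smooth function on the model vector space (Seeley-extended across the boundary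
hyperplane) and must be transported back to a smooth section of `Hom(TP, Hom(TP, ℝ))` along the
smooth map `K⁻¹`. Three elementary facts (O'Neill 1983, Ch. 3, Def. 3.9: pullback of covariant
tensors; Lee 2013, Prop. 13.3 pattern):

* `contMDiffAt_pullbackBilin_of_contMDiffAt` — the pointwise pullback
  `(f^* s)_y(v, w) = s_{f y}(df_y v, df_y w)` (`pullbackBilin`) of a field `s` of bilinear forms
  on `TM` which is `C^n` AT `f y₀` (as a map into the bundle of bilinear forms; `s` arbitrary
  elsewhere) along a map `f : N → M` which is `C^{n+1}` at `y₀` is `C^n` at `y₀` — the proof of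
  the tree's `contMDiff_pullbackBilin_holds` / `contMDiffAt_pullbackBilin` verbatim, with the
  global metric replaced by a field smooth at one point;
* `symmL_trivializationAt_self`, `contMDiffAt_bilinSection_self_iff` — on the MODEL SPACE `H`
  of a model with corners `I : H → E` (the manifold `H` itself, `chartAt = refl`), the
  trivialisations of `TH` are the identity (`trivializationAt_model_space_apply`), so a field of
  bilinear forms `s : H → (E →L E →L ℝ)` is `C^n` at `x₀` as a section of `Hom(TH, Hom(TH, ℝ))`
  iff it is `C^n` at `x₀` as a function;
* `mfderiv_modelWithCorners` — the differential of `I : H → E` (e.g. of the inclusion of the closed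
  half space `EuclideanHalfSpace n → ℝⁿ`) is the identity (Mathlib's
  `ModelWithCorners.hasMFDerivAt`).

No definitions, no named facts (D-0026).

## References

* B. O'Neill, *Semi-Riemannian geometry* (1983), Ch. 3, Def. 3.9 and Lemma 3.35. [ONeill1983]
* J. M. Lee, *Introduction to Riemannian Manifolds*, 2nd ed. (2018), Example 6.44.
  [LeeRiemannianManifolds2018]
-/

noncomputable section

open Bundle Set Function Filter
open scoped Manifold ContDiff Topology

namespace Literature.Geometry.Manifold

open Literature.Geometry.Lorentzian Literature.Geometry.Lorentzian.PseudoRiemannianMetric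

variable {E : Type*} [NormedAddCommGroup E] [NormedSpace ℝ E] {H : Type*} [TopologicalSpace H]
  {I : ModelWithCorners ℝ E H} {M : Type*} [TopologicalSpace M] [ChartedSpace H M]
  {E' : Type*} [NormedAddCommGroup E'] [NormedSpace ℝ E'] {H' : Type*} [TopologicalSpace H']
  {I' : ModelWithCorners ℝ E' H'} {N : Type*} [TopologicalSpace N] [ChartedSpace H' N]
  {n : ℕ∞ω}

/-! ### Pullback of a field of bilinear forms smooth at one point -/

section Pullback

variable [IsManifold I' ∞ N] [IsManifold I ∞ M]

/-- **Pulling back a field of bilinear forms which is smooth at a point.** If `f : N → M` is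
`C^{n+1}` at `y₀` and the field `s` of bilinear forms on `TM` (a map into `Hom(TM, Hom(TM, ℝ))`)
is `C^n` at `f y₀`, then the pulled-back field `f^* s` (`pullbackBilin f s`,
`(f^* s)_y(v, w) = s_{f y}(df_y v, df_y w)`) is `C^n` at `y₀` as a section of
`Hom(TN, Hom(TN, ℝ))`: in tangent coordinates `f^* s = Φᵀ (β ∘ f) Φ` with `Φ` the differential
read in charts (`ContMDiffAt.mfderiv_const`) and `β` the field read in charts
(`contMDiffAt_bilin_iff`). [cite: ONeill1983, Ch. 3, Def. 3.9 and Lemma 3.35] -/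
theorem contMDiffAt_pullbackBilin_of_contMDiffAt {f : N → M} {y₀ : N}
    (hf : ContMDiffAt I' I (n + 1) f y₀)
    {s : Π x : M, TangentSpace I x →L[ℝ] TangentSpace I x →L[ℝ] ℝ}
    (hs : ContMDiffAt I (I.prod 𝓘(ℝ, E →L[ℝ] E →L[ℝ] ℝ)) n
      (fun x : M ↦ TotalSpace.mk' (E →L[ℝ] E →L[ℝ] ℝ)
        (E := fun x : M ↦ TangentSpace I x →L[ℝ] TangentSpace I x →L[ℝ] ℝ) x (s x)) (f y₀)) :
    ContMDiffAt I' (I'.prod 𝓘(ℝ, E' →L[ℝ] E' →L[ℝ] ℝ)) n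
      (fun y : N ↦ TotalSpace.mk' (E' →L[ℝ] E' →L[ℝ] ℝ)
        (E := fun y : N ↦ TangentSpace I' y →L[ℝ] TangentSpace I' y →L[ℝ] ℝ) y
        (pullbackBilin (I := I) (I' := I') f s y)) y₀ := by
  rw [contMDiffAt_bilin_iff]
  refine ⟨contMDiffAt_id, ?_⟩
  set τN := trivializationAt E' (TangentSpace I' : N → Type _) y₀ with hτN
  set τM := trivializationAt E (TangentSpace I : M → Type _) (f y₀) with hτM
  set Φ : N → E' →L[ℝ] E := inTangentCoordinates I' I id f (fun y ↦ mfderiv I' I f y) y₀ with hΦ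
  have hΦs : ContMDiffAt I' 𝓘(ℝ, E' →L[ℝ] E) n Φ y₀ := ContMDiffAt.mfderiv_const hf le_rfl
  set β : M → E →L[ℝ] E →L[ℝ] ℝ := fun x ↦
    (ContinuousLinearMap.precomp ℝ (τM.symmL ℝ x)).comp ((s x).comp (τM.symmL ℝ x)) with hβ
  have hβs : ContMDiffAt I 𝓘(ℝ, E →L[ℝ] E →L[ℝ] ℝ) n β (f y₀) :=
    ((contMDiffAt_bilin_iff (IX := I) (IB := I) (V := (TangentSpace I : M → Type _)) (b := id)
      (s := s) (x₀ := f y₀)).1 hs).2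
  have hf' : ContMDiffAt I' I n f y₀ := hf.of_le le_self_add
  have hβf : ContMDiffAt I' 𝓘(ℝ, E →L[ℝ] E →L[ℝ] ℝ) n (fun y ↦ β (f y)) y₀ :=
    ContMDiffAt.comp y₀ hβs hf'
  have h1 : ContMDiffAt I' 𝓘(ℝ, E' →L[ℝ] E →L[ℝ] ℝ) n (fun y ↦ (β (f y)).comp (Φ y)) y₀ :=
    ContMDiffAt.clm_comp hβf hΦs
  have h2 : ContMDiffAt I' 𝓘(ℝ, (E →L[ℝ] ℝ) →L[ℝ] (E' →L[ℝ] ℝ)) n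
      (fun y ↦ (Φ y).precomp ℝ) y₀ :=
    hΦs.clm_precomp (F₃ := ℝ)
  have hcomp : ContMDiffAt I' 𝓘(ℝ, E' →L[ℝ] E' →L[ℝ] ℝ) n
      (fun y ↦ ((Φ y).precomp ℝ).comp ((β (f y)).comp (Φ y))) y₀ :=
    ContMDiffAt.clm_comp h2 h1
  refine hcomp.congr_of_eventuallyEq ?_
  have hev : ∀ᶠ y in 𝓝 y₀, f y ∈ τM.baseSet :=
    hf.continuousAt.preimage_mem_nhds
      (τM.open_baseSet.mem_nhds (FiberBundle.mem_baseSet_trivializationAt' (f y₀)))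
  filter_upwards [hev] with y hfy
  ext e e'
  have key : ∀ v : E', τM.symmL ℝ (f y) (Φ y v) = mfderiv I' I f y (τN.symmL ℝ y v) := by
    intro v
    simp only [hΦ, inTangentCoordinates, ContinuousLinearMap.inCoordinates,
      ContinuousLinearMap.coe_comp, comp_apply, id_eq]
    exact τM.symmL_continuousLinearMapAt hfy _
  simp only [ContinuousLinearMap.coe_comp, comp_apply, ContinuousLinearMap.precomp_apply,
    pullbackBilin_apply, hβ, key]
  rfl

/-- `ContMDiffOn` form of `contMDiffAt_pullbackBilin_of_contMDiffAt`: if `f` is `C^{n+1}` on an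
open set `U`, and `s` is `C^n` (as a section) at every point of `f(U)`, then `f^* s` is a
`C^n` section on `U`. [cite: ONeill1983, Ch. 3, Def. 3.9 and Lemma 3.35] -/
theorem contMDiffOn_pullbackBilin_of_contMDiffAt {f : N → M} {U : Set N} (hU : IsOpen U)
    (hf : ContMDiffOn I' I (n + 1) f U)
    {s : Π x : M, TangentSpace I x →L[ℝ] TangentSpace I x →L[ℝ] ℝ}
    (hs : ∀ y ∈ U, ContMDiffAt I (I.prod 𝓘(ℝ, E →L[ℝ] E →L[ℝ] ℝ)) n
      (fun x : M ↦ TotalSpace.mk' (E →L[ℝ] E →L[ℝ] ℝ)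
        (E := fun x : M ↦ TangentSpace I x →L[ℝ] TangentSpace I x →L[ℝ] ℝ) x (s x)) (f y)) :
    ContMDiffOn I' (I'.prod 𝓘(ℝ, E' →L[ℝ] E' →L[ℝ] ℝ)) n
      (fun y : N ↦ TotalSpace.mk' (E' →L[ℝ] E' →L[ℝ] ℝ)
        (E := fun y : N ↦ TangentSpace I' y →L[ℝ] TangentSpace I' y →L[ℝ] ℝ) y
        (pullbackBilin (I := I) (I' := I') f s y)) U :=
  fun y hy ↦ (contMDiffAt_pullbackBilin_of_contMDiffAt ((hf y hy).contMDiffAt (hU.mem_nhds hy))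
    (hs y hy)).contMDiffWithinAt

end Pullback

/-! ### Fields of bilinear forms on the model space -/

section ModelSpace

/-- On the model space `H` (as a manifold, `chartAt = refl`), the trivialisations of the tangent
bundle are the identity on every fibre (`trivializationAt_model_space_apply`), so their inverse
fibre maps `symmL` are the identity as well. [folklore] -/
theorem symmL_trivializationAt_self (x₀ x : H) :
    (trivializationAt E (TangentSpace I : H → Type _) x₀).symmL ℝ x = ContinuousLinearMap.id ℝ E := by
  set e := trivializationAt E (TangentSpace I : H → Type _) x₀ with he
  have hx : x ∈ e.baseSet := by
    rw [he, TangentBundle.trivializationAt_baseSet, chartAt_self_eq]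
    exact mem_univ _
  ext v
  have hA : e.continuousLinearMapAt ℝ x v = v := by
    rw [Trivialization.continuousLinearMapAt_apply_of_mem ℝ e hx]
    have h := trivializationAt_model_space_apply (I := I) (⟨x, v⟩ : TangentBundle I H) x₀
    rw [← he] at h
    rw [h]
  conv_lhs => rw [← hA]
  rw [Trivialization.symmL_continuousLinearMapAt e hx]
  rfl

/-- **On the model space, section-smoothness of a field of bilinear forms is smoothness of the
function.** For `s : H → (E →L E →L ℝ)` (a field of bilinear forms on the tangent spaces of the
manifold `H` itself, `T_xH = E`), the map `x ↦ (x, s x)` into `Hom(TH, Hom(TH, ℝ))` is `C^n` at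
`x₀` iff `s` is `C^n` at `x₀` as a map into the normed space `E →L E →L ℝ`
(`contMDiffAt_bilin_iff` with identity trivialisations). [folklore] -/
theorem contMDiffAt_bilinSection_self_iff {s : H → E →L[ℝ] E →L[ℝ] ℝ} {x₀ : H} :
    ContMDiffAt I (I.prod 𝓘(ℝ, E →L[ℝ] E →L[ℝ] ℝ)) n
      (fun x : H ↦ TotalSpace.mk' (E →L[ℝ] E →L[ℝ] ℝ)
        (E := fun x : H ↦ TangentSpace I x →L[ℝ] TangentSpace I x →L[ℝ] ℝ) x (s x)) x₀ ↔
    ContMDiffAt I 𝓘(ℝ, E →L[ℝ] E →L[ℝ] ℝ) n s x₀ := by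
  refine (contMDiffAt_bilin_iff (IX := I) (IB := I) (V := (TangentSpace I : H → Type _)) (b := id)
    (s := fun x ↦ s x) (x₀ := x₀)).trans ?_
  have hpt : ∀ x : H, (ContinuousLinearMap.precomp ℝ
      ((trivializationAt E (TangentSpace I : H → Type _) (id x₀)).symmL ℝ (id x))).comp
        ((s x).comp ((trivializationAt E (TangentSpace I : H → Type _) (id x₀)).symmL ℝ (id x))) =
      s x := by
    intro x
    simp only [id_eq]
    rw [symmL_trivializationAt_self]
    ext v w
    rfl
  have hev : (fun x : H ↦ (ContinuousLinearMap.precomp ℝ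
      ((trivializationAt E (TangentSpace I : H → Type _) (id x₀)).symmL ℝ (id x))).comp
        ((s x).comp ((trivializationAt E (TangentSpace I : H → Type _) (id x₀)).symmL ℝ (id x)))) =ᶠ[𝓝 x₀]
      s :=
    Eventually.of_forall hpt
  exact (and_congr_right fun _ ↦ hev.contMDiffAt_iff).trans
    ⟨fun h ↦ h.2, fun h ↦ ⟨contMDiffAt_id, h⟩⟩

/-- **The differential of the model map `I : H → E` is the identity** (e.g. the inclusion of
the closed half space `EuclideanHalfSpace n ⊆ ℝⁿ`, read as a map from the manifold with boundary
`EuclideanHalfSpace n` to the vector space `ℝⁿ`): Mathlib's `ModelWithCorners.hasMFDerivAt`.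
[folklore] -/
theorem mfderiv_modelWithCorners (x : H) :
    mfderiv I 𝓘(ℝ, E) I x = ContinuousLinearMap.id ℝ E :=
  (ModelWithCorners.hasMFDerivAt I).mfderiv

/-- Chain rule through the model map: for `g : E → X` differentiable at `I x` (as a map from
the vector space), `d(g ∘ I)_x = dg_{I x}` under `T_xH = E`. [folklore] -/
theorem mfderiv_comp_modelWithCorners {X : Type*} [TopologicalSpace X] {HX : Type*}
    [TopologicalSpace HX] {EX : Type*} [NormedAddCommGroup EX] [NormedSpace ℝ EX]
    {J : ModelWithCorners ℝ EX HX} [ChartedSpace HX X] {g : E → X} {x : H}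
    (hg : MDifferentiableAt 𝓘(ℝ, E) J g (I x)) :
    mfderiv I J (g ∘ I) x = mfderiv 𝓘(ℝ, E) J g (I x) := by
  rw [mfderiv_comp x hg (ModelWithCorners.hasMFDerivAt I).mdifferentiableAt,
    mfderiv_modelWithCorners]
  ext v
  rfl

end ModelSpace

end Literature.Geometry.Manifold
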